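import Summits.RiemannHypothesis.RiemannHypothesis.Theorems.HandoffDodgerExplicit
import Summits.RiemannHypothesis.RiemannHypothesis.Theorems.HandoffDodgerAsymptoticsB
import Summits.RiemannHypothesis.RiemannHypothesis.Theorems.HandoffDodgerAsymptoticsC
import Summits.RiemannHypothesis.RiemannHypothesis.Theorems.HandoffDodgerAsymptoticsF
import Summits.RiemannHypothesis.RiemannHypothesis.Theorems.HandoffDodgerAsymptoticsG
import Summits.RiemannHypothesis.RiemannHypothesis.Theorems.HandoffDodgerGenericWindow
import Summits.RiemannHypothesis.RiemannHypothesis.Theorems.HandoffDodgerZeroSumReduction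
import HarnessLib

/-!
# HANDOFF — THE RH-FREE WALL CEILING: `∃ q₀, SubwindowZeroSumFamily (7/100) q₀` (rh-explicit, track «HANDOFF», seat prove-2 gen10, ATTEMPT-16 THEOREM 16.2 / ATTEMPT-19)

HONEST FRAMING. Nothing here bears on the truth of RH. This file assembles the RH-free upper-side bookkeeping of the track:
the explicit mollified zero-dodger (`dodger_witness_explicit`, ATTEMPT-19 §7) at the asymptotic parameter choice of ATTEMPT-19 §8
(parts (A)–(G): `r = 1/(q³+1)`, a generic `ε ∈ [r, 2r]` off the countable resonance set, `b = (log q)/2 − ε`, `T₀ = 2πe^{1+2b}`,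
`k′ = ⌊bT*/π⌋`, `y = (3/5)(log q)^{3/2}`, `N₁ = 4⌈log q⌉`) gives, for every pair of consecutive primes `q < q′` with `q ≥ ⌈e^{204}⌉`,
a Weil test function in the `q`-subwindow whose truncated zero sums sit strictly below the weighted collar at the shift
`δ ≤ (7/100)(log q)^{3/2}q^{−3/2}`: **`∃ q₀, SubwindowZeroSumFamily (7/100) q₀`** (THEOREM), hence the Dodger wall ceiling
`∃ q₀, DodgerWallCeiling (7/100) q₀` and the RH-free UPPER CLAUSE `a*(S_{<q}) < (log q⁺)/2` for all large primes `q`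
(tree `upperClause_of_zeroSumFamily`). No `sorry`, standard axioms; every ingredient is a theorem of this track or of Mathlib.

References: this track (ATTEMPT-16 §§1–6, THEOREMS 16.1–16.2; ATTEMPT-18; ATTEMPT-19 §§1–8).
-/

set_option linter.dupNamespace false

noncomputable section

open Real Complex Set MeasureTheory Literature.NumberTheory.LFunctions Literature.NumberTheory.LFunctions.WeilContinuous

namespace Summit.RiemannHypothesis.RiemannHypothesis.Theorems.Handoff

set_option maxHeartbeats 400000 in
/-- **THEOREM (the RH-free zero-sum family at rate `(7/100)(log q)^{3/2}q^{−3/2}` from `q₀ = ⌈e^{204}⌉` on).**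
[this track, ATTEMPT-16 THEOREM 16.2; ATTEMPT-19 §8′] -/
theorem subwindowZeroSumFamily_exp204 : SubwindowZeroSumFamily (7 / 100) ⌈Real.exp 204⌉₊ := by
  intro q q' hqq' hq₀
  obtain ⟨hqprime, -, hqq, -⟩ := hqq'
  have hq2 : 2 ≤ q := hqprime.two_le
  have hq0 : (0 : ℝ) < q := by exact_mod_cast hqprime.pos
  -- the scale `L = log q ≥ 204`
  have hL204 : 204 ≤ Real.log q := by
    have h1 : Real.exp 204 ≤ q := le_trans (Nat.le_ceil _) (by exact_mod_cast hq₀)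
    have := Real.log_le_log (Real.exp_pos _) h1
    rwa [Real.log_exp] at this
  have hL0 : 0 < Real.log q := by linarith
  -- the mollifier radius `r = 1/(q³+1)`, a generic `ε ∈ [r, 2r]`, the half-width `b = L/2 − ε`
  have hr : (bump (q ^ 3)).rOut = 1 / ((q : ℝ) ^ 3 + 1) := by rw [bump_rOut]; push_cast; ring
  have hr0 : 0 < (bump (q ^ 3)).rOut := (bump (q ^ 3)).rOut_pos
  have hr1 : (bump (q ^ 3)).rOut ≤ 1 := bump_rOut_le_one _
  obtain ⟨ε, ⟨hε1, hε2⟩, hgen⟩ := exists_generic_shift (Real.log q) hr0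
  set b : ℝ := Real.log q / 2 - ε with hb
  have hbq1 : b + (bump (q ^ 3)).rOut ≤ Real.log q / 2 := by linarith
  have hbq2 : Real.log q / 2 ≤ b + 2 * (bump (q ^ 3)).rOut := by linarith
  have hb100 : 100 ≤ b := by linarith
  have hb60 : 60 ≤ b := by linarith
  have hb1 : 1 ≤ b := by linarith
  -- the horizon: parts (A), (B)
  obtain ⟨hside1, hside2⟩ := horizon_side_conditions hb60
  obtain ⟨hA, hB, hT3, hk2, hℓ2, hK1, -⟩ := horizon_index_bounds hb60
  obtain ⟨h101, hT'T₀, hexp2b, -, hcI, hcI2, hcL, hpL, hpU0, hpU, hW1, hW2, hk2', hk04⟩ := horizon_sizes_B hb60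
  have hTT₀ : π * (dodgerKprime b : ℝ) / b ≤ 2 * π * Real.exp (1 + 2 * b) := hT'T₀
  have hT₀T : 2 * π * Real.exp (1 + 2 * b) ≤ 101 / 100 * (π * (dodgerKprime b : ℝ) / b) := h101
  have hp : 0 < dodgerPL b := lt_of_lt_of_le (by have := Real.pi_pos; positivity) hpL
  -- part (G): the window conditions
  obtain ⟨⟨hL1, hL2⟩, ⟨hδU0, hδU1, hδb⟩, hr6, hδC, hwin, ⟨hQ0, hQ⟩⟩ :=
    window_conditions (T := π * (dodgerKprime b : ℝ) / b) (pL := dodgerPL b) (pU := dodgerPU b)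
      (y := 3 / 5 * (Real.log q * Real.sqrt (Real.log q))) hq2 rfl hr hbq1 hbq2 hb100 hexp2b hTT₀ hT₀T hpL hpU0 hpU
      rfl rfl rfl
  -- part (D): the profile-control constants
  obtain ⟨hN, hρ11, hρ2e, hκ⟩ :=
    profile_constants (T := π * (dodgerKprime b : ℝ) / b) (k := (dodgerKprime b : ℝ)) (pL := dodgerPL b) (W := dodgerW b)
      (y := 3 / 5 * (Real.log q * Real.sqrt (Real.log q))) (N₁ := 4 * ⌈Real.log q⌉₊) hb100 hL1 hL2 hexp2b hW1 hW2 hk2'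
      hk04 hpL rfl rfl rfl rfl rfl rfl rfl rfl rfl
  -- part (C): the profile value
  have hΦ := profile_value_lower (by linarith : 43 ≤ Real.log q)
    (summable_dodgerPhiTerm (9 * (3 / 5 * (Real.log q * Real.sqrt (Real.log q))) ^ 2 / 64)).hasSum
  -- parts (E), (F): the comparison
  have hlt := cost_lt_gain (cI := dodgerCI b) (r := (bump (q ^ 3)).rOut) hb100 hL1 hL2 hexp2b hTT₀ hT₀T hk2' hk04 hcI hcI2
    rfl rfl hδU0 hδU1 hQ0 hQ hκ hr6 rfl rfl hpU0 hpU hΦ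
  -- the genericity of the lattice
  have hgen' : ∀ ρ : ℂ, riemannZeta ρ = 0 → 0 < ρ.im →
      ∀ k ∈ Finset.range (zetaZeroCount (π * (dodgerKprime b : ℝ) / b)), dodgerNode ρ - latticeFreq b (k + 1) ≠ 0 := by
    intro ρ hζ hρ k _
    have h := hgen ρ hζ hρ.ne' k
    rw [sub_ne_zero]
    simpa [dodgerNode, latticeFreq] using h
  -- the explicit dodger
  exact dodger_witness_explicit (q := q) (q' := q') (b := b) (T₀ := dodgerT₀ b)
    (y := 3 / 5 * (Real.log q * Real.sqrt (Real.log q))) (C := 7 / 100) (n := q ^ 3) (k' := dodgerKprime b)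
    (N₁ := 4 * ⌈Real.log q⌉₊) hb1 rfl hside1 hside2 hA hB hT3 hk2 hℓ2 hK1 rfl rfl rfl rfl rfl rfl (by positivity)
    rfl rfl rfl rfl rfl rfl rfl rfl rfl hcL hp hN hρ11 hρ2e (le_trans (by norm_num) hκ) hδb hr6 hδC (hwin q' (by omega)) hbq1 hbq2
    hgen' hlt

/-- **THEOREM (∃-form).** `∃ q₀, SubwindowZeroSumFamily (7/100) q₀`. [this track, ATTEMPT-16 THEOREM 16.2; ATTEMPT-19] -/
theorem exists_subwindowZeroSumFamily : ∃ q₀ : ℕ, SubwindowZeroSumFamily (7 / 100) q₀ :=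
  ⟨_, subwindowZeroSumFamily_exp204⟩

/-- **COROLLARY (the Dodger wall ceiling, RH-free).** [this track, ATTEMPT-16 THEOREM 16.2] -/
theorem exists_dodgerWallCeiling : ∃ q₀ : ℕ, DodgerWallCeiling (7 / 100) q₀ := by
  obtain ⟨q₀, h⟩ := exists_subwindowZeroSumFamily
  exact ⟨q₀, dodgerWallCeiling_of_zeroSumFamily h⟩

/-- **COROLLARY (the RH-free UPPER CLAUSE for all large primes).** For every prime `q ≥ q₀`: `a*(S_{<q}) < (log q⁺)/2`, `q⁺` the
next prime. [this track, ATTEMPT-16 THEOREM 16.2 + HANDOFF-STATEMENT §J.22 (3)] -/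
theorem upperClause_eventually : ∃ q₀ : ℕ, ∀ q : ℕ, q.Prime → q₀ ≤ q →
    MotivicDoor.SemilocalThreshold.weilSemilocalThreshold (Nat.primesBelow q) <
      Real.log (HandoffDecomposition.nextPrime q) / 2 := by
  obtain ⟨q₀, h⟩ := exists_subwindowZeroSumFamily
  refine ⟨max q₀ 3, fun q hq hq₀ => ?_⟩
  exact upperClause_of_zeroSumFamily h (by rw [abs_of_pos (by norm_num)]) hq (le_trans (le_max_left _ _) hq₀)
    (le_trans (le_max_right _ _) hq₀)

end Summit.RiemannHypothesis.RiemannHypothesis.Theorems.Handoff
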